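import Summits.AtomisticToContinuum.HydrodynamicLimit.Theses.AntiMazurCoboundaries
import Literature.Probability.LatticeModels.PolymerGas
import HarnessLib

/-!
# Objects of the crux line `tilt-analyticity-transfer` (crux `CellForecastPressureDecay`,
# stmt-AtomisticToContinuum-13915; route AntiMazurCoboundaries)

Objects module of the registered skeleton
`Cruxes/CellForecastPressureDecay/Lines/tilt-analyticity-transfer.lean` (lead
`prover-line-stmt-AtomisticToContinuum-13915-0`), moved into an importable `Theorems` module so that
the stub helper files of the line (one per registered stub, `--supports stmt-AtomisticToContinuum-13915`)
and the eventual closing file share ONE copy of them: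

* § 1 the cell frame of the crux, named: `Flows`, `cellLaw` (the canonical cell Gibbs law `P_{n,L}`,
  verbatim the crux's measure), `windowAvg` (the crux's summand `aᵢ = T⁻¹∫₀ᵀ g(v^{fc}_i)`), the complex
  tilt partition function `tiltZ` (`Z(c) = ∫ e^{2cΣaᵢ} dP_{n,L}`), with the proved bookkeeping
  `measurable_windowAvg`, `abs_windowAvg_le`, `lintegral_exp_eq_norm_tiltZ` (at real tilt the crux's
  `lintegral` IS `‖Z(c)‖`);
* § 2 the abstract cluster-expansion vocabulary in which the two "analyticity" stubs are typed: the label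
  variables `labelVar w c j = e^{2c w_j} − 1` (and `labelField`, their instance on window averages), the
  moments `momentOf P u d = E ∏_{j∈d} u_j`, the JOINT CUMULANTS `jointCumulant P u B` defined through
  `cumulantOfMoments` by the ANCHORED moment–cumulant recursion
  `m(B) = Σ_{min B ∈ A ⊆ B} κ(A) · m(B ∖ A)` (`m(∅)` read as `1`; Leonov–Shiryaev 1959, Speed 1983 — it is
  the unique solution of these relations, hence the usual Ursell function; the Möbius form
  `Σ_π (−1)^{|π|−1}(|π|−1)! ∏ m` is not needed on this line), the overlap relation of label sets and the
  partition function `subsetGasZ κ S` of the hard-core SUBSET POLYMER GAS on `S` (polymers = nonempty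
  subsets, incompatible iff overlapping, activities `κ`), an instance of the tree's
  `Literature.Probability.LatticeModels.polymerPartitionFunction` (Dobrushin's criterion PROVED there);
* § 3 the registered bookkeeping stub `stub_objects` (S0): unfolding and vanishing of the anchored
  cumulants, `subsetGasZ 0 S = 1`.

Design choice recorded: the planner's skeleton defined `jointCumulant` by the Möbius sum over
`Finpartition B`; the lead replaced it by the anchored recursion (same numbers), because the polymer
representation `E∏_{j∈S}(1+u_j) = subsetGasZ (jointCumulant P u) S` then follows by a plain strong induction
on `S` matching `polymerPartitionFunction_insert`, with no Möbius inversion on the partition lattice.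
-/

noncomputable section

open MeasureTheory Set Metric Filter ProbabilityTheory Topology
open scoped ENNReal BigOperators
open Literature.Analysis.FluidPDE Literature.MathematicalPhysics.KineticTheory
open Literature.Probability.LatticeModels (polymerPartitionFunction)

namespace Summit.AtomisticToContinuum.HydrodynamicLimit.Theorems.TiltAnalyticity

/-! ## § 1 The cell frame of the crux -/

/-- Families of Euclidean hard-sphere flows in `ℝ³` with diameter `σ`, one for every particle number
(the crux's `Ψ`). -/
abbrev Flows (σ : ℝ) : Type := (k : ℕ) → HardSphereFlow (Euclidean.geometry (Fin 3)) σ k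

/-- The canonical cell Gibbs law `P_{n,L}` of the crux, verbatim: `n` spheres of diameter `σ`,
positions in `[0,L]³` (hard core), standard Maxwellian velocities. -/
def cellLaw (σ : ℝ) (n : ℕ) (L : ℝ) (Φ : HardSphereFlow (Euclidean.geometry (Fin 3)) σ n) :
    Measure (Config n (Fin 3) V3) :=
  particleLaw Φ (canonicalDensity (Euclidean.geometry (Fin 3)) σ n
    (fun p => Set.indicator {x : V3 | ∀ k, x k ∈ Set.Icc (0 : ℝ) L} (fun _ => (1 : ℝ)) p.1 *
      globalMaxwellian p.2))

/-- The window average `aᵢ(z) = T⁻¹ ∫₀ᵀ g(v^{fc}_i(t)) dt` of `g` along the `R`-local forecast of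
particle `i` (the crux's summand, verbatim). -/
def windowAvg {σ : ℝ} {n : ℕ} (Ψ : Flows σ) (R T : ℝ) (g : V3 → ℝ) (z : Config n (Fin 3) V3)
    (i : Fin n) : ℝ :=
  T⁻¹ * ∫ t in (0 : ℝ)..T, g (localClusterState Ψ R t z i).2

/-- The COMPLEX TILT partition function `Z(c) = ∫ exp(2c Σᵢ aᵢ) dP_{n,L}` (entire in `c`; at real
`c` its norm is the crux's left-hand side, `lintegral_exp_eq_norm_tiltZ`). -/
def tiltZ {σ : ℝ} (n : ℕ) (Ψ : Flows σ) (R T L : ℝ) (g : V3 → ℝ) (c : ℂ) : ℂ :=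
  ∫ z, Complex.exp (2 * c * ((∑ i : Fin n, windowAvg Ψ R T g z i : ℝ) : ℂ)) ∂(cellLaw σ n L (Ψ n))

/-- **Measurability of the window average** in the configuration (joint measurability of the local
cluster state, `measurable_localClusterState`, and of parametric Bochner integrals). -/
theorem measurable_windowAvg {σ : ℝ} {n : ℕ} (Ψ : Flows σ) (R T : ℝ) {g : V3 → ℝ}
    (hg : Measurable g) (i : Fin n) :
    Measurable fun z : Config n (Fin 3) V3 => windowAvg Ψ R T g z i := by
  have hG : ∀ x : V3, Continuous ((Euclidean.geometry (Fin 3)).translate x) :=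
    fun x => (continuous_const.add continuous_id : Continuous fun v : V3 => x + v)
  have hI : Measurable (Function.uncurry fun (t : ℝ) (z : Config n (Fin 3) V3) =>
      g (localClusterState Ψ R t z i).2) :=
    hg.comp (measurable_localClusterState Ψ hG Euclidean.measurable_geometry_sepVec R i).snd
  have h : ∀ μ : Measure ℝ, SFinite μ → Measurable fun z : Config n (Fin 3) V3 =>
      ∫ t, g (localClusterState Ψ R t z i).2 ∂μ := fun μ _ =>
    (hI.stronglyMeasurable.integral_prod_left (μ := μ)).measurable
  simp only [windowAvg, intervalIntegral]
  exact ((h _ inferInstance).sub (h _ inferInstance)).const_mul _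

/-- `|aᵢ| ≤ κ` when `|g| ≤ κ` and `T > 0` (the interval integral is bounded by `κ T`). -/
theorem abs_windowAvg_le {σ : ℝ} {n : ℕ} (Ψ : Flows σ) {R T : ℝ} (hT : 0 < T) {g : V3 → ℝ}
    {κ : ℝ} (hgb : ∀ v, |g v| ≤ κ) (z : Config n (Fin 3) V3) (i : Fin n) :
    |windowAvg Ψ R T g z i| ≤ κ := by
  have h := intervalIntegral.norm_integral_le_of_norm_le_const (a := (0 : ℝ)) (b := T)
    (f := fun t => g (localClusterState Ψ R t z i).2) (C := κ) (fun t _ => by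
      rw [Real.norm_eq_abs]; exact hgb _)
  rw [sub_zero, abs_of_pos hT, Real.norm_eq_abs] at h
  rw [windowAvg, abs_mul, abs_inv, abs_of_pos hT]
  calc T⁻¹ * |∫ t in (0 : ℝ)..T, g (localClusterState Ψ R t z i).2| ≤ T⁻¹ * (κ * T) :=
        mul_le_mul_of_nonneg_left h (inv_nonneg.2 hT.le)
    _ = κ := by field_simp

/-- **At real tilt the crux functional is `‖Z(c)‖`**: for `|g| ≤ κ`, `T > 0` and a finite cell law,
`∫⁻ e^{2cΣaᵢ} dP = ofReal ‖tiltZ c‖` (bounded measurable integrand; `integral_ofReal`). -/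
theorem lintegral_exp_eq_norm_tiltZ {σ : ℝ} {n : ℕ} (Ψ : Flows σ) {R T : ℝ} (L : ℝ) (hT : 0 < T)
    {g : V3 → ℝ} {κ : ℝ} (hg : Measurable g) (hgb : ∀ v, |g v| ≤ κ)
    [IsFiniteMeasure (cellLaw σ n L (Ψ n))] (c : ℝ) :
    ∫⁻ z, ENNReal.ofReal (Real.exp (2 * c * ∑ i : Fin n, windowAvg Ψ R T g z i))
        ∂(cellLaw σ n L (Ψ n)) = ENNReal.ofReal ‖tiltZ n Ψ R T L g c‖ := by
  have hSm : Measurable fun z : Config n (Fin 3) V3 => ∑ i : Fin n, windowAvg Ψ R T g z i :=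
    Finset.measurable_sum _ fun i _ => measurable_windowAvg Ψ R T hg i
  have hfm : Measurable fun z : Config n (Fin 3) V3 =>
      Real.exp (2 * c * ∑ i : Fin n, windowAvg Ψ R T g z i) := (hSm.const_mul _).exp
  have hbound : ∀ z : Config n (Fin 3) V3,
      |2 * c * ∑ i : Fin n, windowAvg Ψ R T g z i| ≤ 2 * |c| * (n * κ) := by
    intro z
    rw [abs_mul, abs_mul, abs_two]
    refine mul_le_mul_of_nonneg_left ?_ (by positivity)
    calc |∑ i : Fin n, windowAvg Ψ R T g z i| ≤ ∑ i : Fin n, |windowAvg Ψ R T g z i| :=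
          Finset.abs_sum_le_sum_abs _ _
      _ ≤ ∑ _i : Fin n, κ := Finset.sum_le_sum fun i _ => abs_windowAvg_le Ψ hT hgb z i
      _ = n * κ := by simp
  have hfi : Integrable (fun z : Config n (Fin 3) V3 =>
      Real.exp (2 * c * ∑ i : Fin n, windowAvg Ψ R T g z i)) (cellLaw σ n L (Ψ n)) := by
    refine (integrable_const (Real.exp (2 * |c| * (n * κ)))).mono' hfm.aestronglyMeasurable
      (Eventually.of_forall fun z => ?_)
    rw [Real.norm_eq_abs, abs_of_pos (Real.exp_pos _)]
    exact Real.exp_le_exp.2 ((le_abs_self _).trans (hbound z))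
  have h1 := (ofReal_integral_eq_lintegral_ofReal hfi
    (Eventually.of_forall fun z => (Real.exp_pos _).le)).symm
  have h2 : tiltZ n Ψ R T L g c = ((∫ z, Real.exp (2 * c * ∑ i : Fin n, windowAvg Ψ R T g z i)
      ∂(cellLaw σ n L (Ψ n)) : ℝ) : ℂ) := by
    rw [← integral_complex_ofReal]
    simp only [tiltZ]
    congr 1
    funext z
    rw [Complex.ofReal_exp]
    push_cast
    ring_nf
  have h3 : ‖tiltZ n Ψ R T L g c‖ =
      ∫ z, Real.exp (2 * c * ∑ i : Fin n, windowAvg Ψ R T g z i) ∂(cellLaw σ n L (Ψ n)) := by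
    rw [h2, Complex.norm_real, Real.norm_eq_abs,
      abs_of_nonneg (integral_nonneg fun z => (Real.exp_pos _).le)]
  rw [h3]
  exact h1

/-! ## § 2 Label variables, anchored joint cumulants, the subset polymer gas -/

/-- The LABEL VARIABLES `u_j(c) = exp(2c w_j) − 1` of a family of real variables `w_j` at complex tilt
`c` (`|u_j| ≤ e^{2|c|A} − 1` when `|w_j| ≤ A`; `u_j(0) = 0`). -/
def labelVar {Ω ι : Type*} (w : ι → Ω → ℝ) (c : ℂ) (j : ι) (ω : Ω) : ℂ :=
  Complex.exp (2 * c * (w j ω : ℂ)) - 1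

/-- The LABEL FIELD of the line: the label variables of the window averages,
`u_j(c)(z) = exp(2c a_j(z)) − 1`. -/
def labelField {σ : ℝ} {n : ℕ} (Ψ : Flows σ) (R T : ℝ) (g : V3 → ℝ) (c : ℂ) (j : Fin n)
    (z : Config n (Fin 3) V3) : ℂ :=
  labelVar (fun j z => windowAvg Ψ R T g z j) c j z

/-- The MOMENT `m(d) = E[∏_{j ∈ d} u_j]` of a family of complex variables under `P` (`m(∅) = P(Ω)`). -/
def momentOf {Ω ι : Type*} [MeasurableSpace Ω] (P : Measure Ω) (u : ι → Ω → ℂ) (d : Finset ι) : ℂ :=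
  ∫ ω, ∏ j ∈ d, u j ω ∂P

/-- CUMULANTS FROM MOMENTS by the anchored moment–cumulant recursion: for nonempty `B` with least
element `i₀`, `κ(B) = m(B) − Σ_{A ⊂ B, i₀ ∈ A} κ(A) · m(B ∖ A)` (so that
`m(B) = Σ_{i₀ ∈ A ⊆ B} κ(A) m(B ∖ A)` with `m(∅)` read as `1`), and `κ(∅) = 0`. Defined by strong
induction on `B` (`Finset.strongInduction`). For `m` the moments of random variables this is the joint
cumulant (Ursell function; Leonov–Shiryaev 1959): the anchored relations determine `κ` uniquely and the
usual cumulants satisfy them (group the partition expansion by the block of `i₀`). -/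
def cumulantOfMoments {ι : Type*} [LinearOrder ι] (m : Finset ι → ℂ) : Finset ι → ℂ :=
  Finset.strongInduction fun B κ =>
    if h : B.Nonempty then
      m B - ∑ A ∈ B.powerset, if hA : A ⊂ B ∧ B.min' h ∈ A then κ A hA.1 * m (B \ A) else 0
    else 0

/-- The JOINT CUMULANT `κ_B` of the complex variables `(u_j)_{j ∈ B}` under `P`: the anchored cumulant
of their moments. -/
def jointCumulant {Ω ι : Type*} [MeasurableSpace Ω] [LinearOrder ι] (P : Measure Ω) (u : ι → Ω → ℂ) :
    Finset ι → ℂ :=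
  cumulantOfMoments (momentOf P u)

/-- Two label sets OVERLAP if they intersect (or coincide — which makes the relation reflexive also
at `∅`, as `polymerPartitionFunction_ne_zero_and_ratio_le` wants; on nonempty sets it is plain
intersection). This is the incompatibility relation of the subset polymer gas. -/
def Overlap {ι : Type*} (B B' : Finset ι) : Prop := ¬ Disjoint B B' ∨ B = B'

/-- `Overlap` is decidable on label sets with decidable equality. -/
instance {ι : Type*} [DecidableEq ι] : DecidableRel (Overlap (ι := ι)) := fun B B' =>
  inferInstanceAs (Decidable (¬ Disjoint B B' ∨ B = B'))

/-- `Overlap` is reflexive. -/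
theorem overlap_refl {ι : Type*} (B : Finset ι) : Overlap B B := Or.inr rfl

/-- `Overlap` is symmetric. -/
theorem overlap_symm {ι : Type*} (B B' : Finset ι) (h : Overlap B B') : Overlap B' B := by
  rcases h with h | rfl
  · exact Or.inl fun h' => h h'.symm
  · exact Or.inr rfl

/-- The partition function of the hard-core SUBSET POLYMER GAS on `S` with activities `κ`: polymers
are the nonempty subsets of `S`, two polymers are incompatible iff they overlap,
`subsetGasZ κ S = Σ_{F pairwise disjoint family of nonempty subsets of S} ∏_{B ∈ F} κ B`
(the tree's `polymerPartitionFunction`). -/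
def subsetGasZ {ι : Type*} [DecidableEq ι] (κ : Finset ι → ℂ) (S : Finset ι) : ℂ :=
  polymerPartitionFunction Overlap κ (S.powerset.filter Finset.Nonempty)

/-! ### API of the anchored cumulants -/

section Cumulants

variable {ι : Type*} [LinearOrder ι] (m : Finset ι → ℂ)

/-- `κ(∅) = 0`. -/
theorem cumulantOfMoments_empty : cumulantOfMoments m ∅ = 0 := by
  rw [cumulantOfMoments, Finset.strongInduction_eq, dif_neg Finset.not_nonempty_empty]

/-- `κ(B) = 0` if `B` is not nonempty. -/
theorem cumulantOfMoments_of_not_nonempty {B : Finset ι} (h : ¬ B.Nonempty) :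
    cumulantOfMoments m B = 0 := by
  rw [Finset.not_nonempty_iff_eq_empty.1 h, cumulantOfMoments_empty]

/-- **Unfolding of the anchored recursion**: for nonempty `B` with least element `i₀ = B.min' h`,
`κ(B) = m(B) − Σ_{A ⊂ B, i₀ ∈ A} κ(A) · m(B ∖ A)`. -/
theorem cumulantOfMoments_eq {B : Finset ι} (h : B.Nonempty) :
    cumulantOfMoments m B = m B -
      ∑ A ∈ B.powerset.filter (fun A => A ⊂ B ∧ B.min' h ∈ A),
        cumulantOfMoments m A * m (B \ A) := by
  conv_lhs => unfold cumulantOfMoments; rw [Finset.strongInduction_eq]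
  simp only [dif_pos h, dite_eq_ite]
  rw [Finset.sum_filter]
  rfl

/-- **The anchored moment–cumulant formula**: for nonempty `B`,
`m(B) = κ(B) + Σ_{A ⊂ B, min B ∈ A} κ(A) · m(B ∖ A)`. -/
theorem moment_eq_cumulant_add {B : Finset ι} (h : B.Nonempty) :
    m B = cumulantOfMoments m B +
      ∑ A ∈ B.powerset.filter (fun A => A ⊂ B ∧ B.min' h ∈ A),
        cumulantOfMoments m A * m (B \ A) := by
  rw [cumulantOfMoments_eq m h, sub_add_cancel]

/-- **Vanishing**: if all moments of nonempty index sets vanish, so do all cumulants. -/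
theorem cumulantOfMoments_eq_zero (hm : ∀ d : Finset ι, d.Nonempty → m d = 0) (B : Finset ι) :
    cumulantOfMoments m B = 0 := by
  by_cases h : B.Nonempty
  · rw [cumulantOfMoments_eq m h, hm B h, zero_sub, neg_eq_zero]
    refine Finset.sum_eq_zero fun A hA => ?_
    have hA' : A ⊂ B := (Finset.mem_filter.1 hA).2.1
    have hne : (B \ A).Nonempty := by
      rw [Finset.sdiff_nonempty]
      exact fun hBA => hA'.2 hBA
    rw [hm _ hne, mul_zero]
  · exact cumulantOfMoments_of_not_nonempty m h

end Cumulants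

/-- `u_j(0) = 0`: the label variables vanish at zero tilt. -/
theorem labelVar_zero {Ω ι : Type*} (w : ι → Ω → ℝ) (j : ι) (ω : Ω) : labelVar w 0 j ω = 0 := by
  simp [labelVar]

/-- Moments of identically vanishing variables over nonempty index sets vanish. -/
theorem momentOf_eq_zero_of_forall {Ω ι : Type*} [MeasurableSpace Ω] (P : Measure Ω)
    {u : ι → Ω → ℂ} (hu : ∀ j ω, u j ω = 0) {d : Finset ι} (hd : d.Nonempty) :
    momentOf P u d = 0 := by
  obtain ⟨j, hj⟩ := hd
  have : ∀ ω, ∏ k ∈ d, u k ω = 0 := fun ω => Finset.prod_eq_zero hj (hu j ω)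
  simp [momentOf, this]

/-- `κ_∅ = 0`. -/
theorem jointCumulant_empty {Ω ι : Type*} [MeasurableSpace Ω] [LinearOrder ι] (P : Measure Ω)
    (u : ι → Ω → ℂ) : jointCumulant P u ∅ = 0 :=
  cumulantOfMoments_empty _

/-- Joint cumulants of identically vanishing variables vanish (used at zero tilt: `κ_B(0) = 0`). -/
theorem jointCumulant_eq_zero_of_forall {Ω ι : Type*} [MeasurableSpace Ω] [LinearOrder ι]
    (P : Measure Ω) {u : ι → Ω → ℂ} (hu : ∀ j ω, u j ω = 0) (B : Finset ι) :
    jointCumulant P u B = 0 :=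
  cumulantOfMoments_eq_zero _ (fun _ hd => momentOf_eq_zero_of_forall P hu hd) B

/-- At zero activity the subset polymer gas has partition function `1` (only the empty family). -/
theorem subsetGasZ_zero {ι : Type*} [DecidableEq ι] (S : Finset ι) :
    subsetGasZ (fun _ => (0 : ℂ)) S = 1 := by
  unfold subsetGasZ polymerPartitionFunction
  rw [Finset.sum_eq_single_of_mem ∅ (Finset.empty_mem_powerset _)]
  · simp [Literature.Probability.LatticeModels.IsCompatible]
  · intro A _ hA
    obtain ⟨γ, hγ⟩ := Finset.nonempty_iff_ne_empty.2 hA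
    split_ifs
    · exact Finset.prod_eq_zero hγ rfl
    · rfl

/-! ## § 3 The registered bookkeeping stub S0 -/

/-- **Registered stub S0 `stub_objects`** of the line `tilt-analyticity-transfer`
(crux stmt-AtomisticToContinuum-13915): (i) the unfolding of the anchored cumulant recursion,
(ii) vanishing of the anchored cumulants when all moments of nonempty sets vanish, (iii) the subset
polymer gas at zero activity has partition function `1`. [folklore] -/
theorem stub_objects :
    (∀ (ι : Type) [LinearOrder ι] (m : Finset ι → ℂ) (B : Finset ι) (h : B.Nonempty),
      cumulantOfMoments m B = m B -
        ∑ A ∈ B.powerset.filter (fun A => A ⊂ B ∧ B.min' h ∈ A),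
          cumulantOfMoments m A * m (B \ A)) ∧
    (∀ (ι : Type) [LinearOrder ι] (m : Finset ι → ℂ),
      (∀ d : Finset ι, d.Nonempty → m d = 0) → ∀ B : Finset ι, cumulantOfMoments m B = 0) ∧
    (∀ (ι : Type) [DecidableEq ι] (S : Finset ι), subsetGasZ (fun _ => (0 : ℂ)) S = 1) :=
  ⟨fun _ _ m _ h => cumulantOfMoments_eq m h, fun _ _ m hm B => cumulantOfMoments_eq_zero m hm B,
    fun _ _ S => subsetGasZ_zero S⟩

end Summit.AtomisticToContinuum.HydrodynamicLimit.Theorems.TiltAnalyticity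

end
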